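import Summits.MatrixMultiplication.MatrixMultiplication.Theorems.FarEdgeDescentChainCap
import Summits.MatrixMultiplication.MatrixMultiplication.Theorems.FarEdgeDescentChainCapCriterion

/-!
# Far-edge descent, kernel XL-C₂ — the chain cap at `β = 3/2` and `β = 19/10`, unconditionally

The squaring criterion and the cut-off condition of `chain_cap` (kernel XL-B) discharged by rational
arithmetic (`norm_num`) via the cell reduction of kernel XL-C₁, at two values of the dial:
* `β = 3/2` (the lightest anchoring the Strassen floor allows, XXXIX-A), `z = 0` (narrowness = the
  narrow-leg fraction), `V_min = 1/7 = φ₂` (ONE node floor, depth `2`: `(7/4)·T₂ ≤ (3/2)·L`),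
  `γ = 9/10`, `V† = 5/6`; share cells `[2/5, 3/7], [3/7, 6/13], [6/13, 1/2]` with witnesses
  `W = 3/14, 8/35, 1/4` (`criterion_three_halves`; tightest cell:
  `(9/8)^10 = 3.247 ≤ (8/7)^9 = 3.326`);
* `β = 19/10` (deep in the regime where pure squaring towers already fail only at depth `10`,
  XXXIX-I), `z = 99/100`, `V_min = 457/10000 < (99/100)^8·φ₁₀` (ONE node floor, depth `10`),
  `γ = 9/10`, `V† = 1 − 1/600`; one cell `[10/29, 5/14]`, witness `W = 663/10000`
  (`criterion_nineteen_tenths`; `(57/56)^10 = 1.1936 ≤ (9543/9337)^9 = 1.2170`).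
Consequences `chain_cap_three_halves`, `chain_cap_nineteen_tenths`: along EVERY chain schedule of
the floor-projected dial at these `β`, `y_k ≤ C·(ℓ_k/ℓ_0)^{log₂(4/3)}` with an explicit `C` — the
dial's order cannot exceed Schönhage's `θ_S = 0.7095…` there, whatever the schedule (memo NODE-g60
§2 has the numerical margin ≈ 1.3 uniformly on `β ∈ [3/2, 2)`; two more cells would certify any given `β`).

HONEST FRAMING: MODEL level; no `sorry`, no new axioms, no definitions.  References: kernels XL-B,
XL-C₁; Schönhage 1981 [Schonhage1981]; Landsberg–Ottaviani 2015 [LandsbergOttaviani2015].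
-/

noncomputable section

set_option linter.dupNamespace false

namespace Summit.MatrixMultiplication.MatrixMultiplication.Theorems.FarEdgeDescentChainCapInstances

open Summit.MatrixMultiplication.MatrixMultiplication.Theorems.FarEdgeDescentChainCapSteps
open Summit.MatrixMultiplication.MatrixMultiplication.Theorems.FarEdgeDescentChainCap
open Summit.MatrixMultiplication.MatrixMultiplication.Theorems.FarEdgeDescentChainCapCriterion

/-! ## β = 3/2 -/

/-- **Squaring criterion at `β = 3/2`** (`z = 0`, `V_min = 1/7`, `γ = 9/10`): three share cells. -/
theorem criterion_three_halves :
    ∀ lam V : ℝ, 0 < lam → (2 * (3 / 2 : ℝ) - 1) * lam ≤ 1 → 0 ≤ V → V < 1 →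
      (1 / 7 : ℝ) ≤
        (2 * (1 - (3 / 2 : ℝ) * lam) * V + (0 : ℝ) * lam * V ^ 2)
          / (2 - (2 * (3 / 2 : ℝ) - 1) * lam) →
      Real.log (2 * (1 - ((3 / 2 : ℝ) - 1) * lam) / (2 - (2 * (3 / 2 : ℝ) - 1) * lam))
          - Real.log (4 / 3) ≤
        (9 / 10 : ℝ) *
          (Real.log (1 - (2 * (1 - (3 / 2 : ℝ) * lam) * V + (0 : ℝ) * lam * V ^ 2)
            / (2 - (2 * (3 / 2 : ℝ) - 1) * lam)) - Real.log (1 - V)) := by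
  intro lam V h0 h1 hV0 hV1 hfloor
  have hβ : (1:ℝ) < 3 / 2 := by norm_num
  rcases le_or_gt lam (2 / 5) with hlow | hgt
  · exact crit_low hβ (by norm_num) (by norm_num) h0 h1 (by linarith) hV0 hV1 hfloor
  rcases le_or_gt lam (3 / 7) with hc | hgt2
  · refine crit_cell (la := 2 / 5) (lb := 3 / 7) (W := 3 / 14) hβ (by norm_num) (by norm_num)
      (by norm_num) (by norm_num) (by norm_num) (by norm_num) (by norm_num) (by norm_num)
      (by norm_num) ?_ hgt.le hc hV0 hV1 hfloor
    exact check_nine_tenths (by norm_num) (by norm_num) (by norm_num) (by norm_num)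
  rcases le_or_gt lam (6 / 13) with hc | hgt3
  · refine crit_cell (la := 3 / 7) (lb := 6 / 13) (W := 8 / 35) hβ (by norm_num) (by norm_num)
      (by norm_num) (by norm_num) (by norm_num) (by norm_num) (by norm_num) (by norm_num)
      (by norm_num) ?_ hgt2.le hc hV0 hV1 hfloor
    exact check_nine_tenths (by norm_num) (by norm_num) (by norm_num) (by norm_num)
  · refine crit_cell (la := 6 / 13) (lb := 1 / 2) (W := 1 / 4) hβ (by norm_num) (by norm_num)
      (by norm_num) (by norm_num) (by norm_num) (by norm_num) (by norm_num) (by norm_num)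
      (by norm_num) ?_ hgt3.le (by linarith) hV0 hV1 hfloor
    exact check_nine_tenths (by norm_num) (by norm_num) (by norm_num) (by norm_num)

/-- The cut-off condition at `β = 3/2`, `z = 0`, `V† = 5/6`, `γ = 9/10`. -/
theorem cutoff_three_halves :
    Real.log (2 * (3 / 2 : ℝ) / (2 * (3 / 2 : ℝ) - 1)) - Real.log (4 / 3) ≤
      (9 / 10 : ℝ) * (Real.log ((1 - (0 : ℝ)) / 3) - Real.log (1 - (5 / 6 : ℝ))) :=
  check_nine_tenths (by norm_num) (by norm_num) (by norm_num) (by norm_num)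

/-- **Chain cap at `β = 3/2`, unconditionally.**  Every chain schedule of the floor-projected dial
(narrowness = narrow fraction, one node floor `V' ≥ 1/7` on squarings, heavy bases `b ≥ 1/2`) has
`y_k ≤ max(80R, y_0)·(1/(2λ_0))·6^{9/10}·(ℓ_k/ℓ_0)^{log₂(4/3)}`. -/
theorem chain_cap_three_halves {R : ℝ} (hR : 0 ≤ R)
    (lam V y ℓ μ yb ℓb : ℕ → ℝ) (sq : ℕ → Prop)
    (hlam0 : 0 < lam 0) (hlam0' : (2 * (3 / 2 : ℝ) - 1) * lam 0 ≤ 1) (hV0 : 0 ≤ V 0)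
    (hV0' : V 0 ≤ 1)
    (hy0 : 0 < y 0) (hℓ0 : 0 < ℓ 0)
    (hsq_lam : ∀ k, sq k → lam (k + 1) = 2 * lam k - (2 * (3 / 2 : ℝ) - 1) * lam k ^ 2)
    (hsq_V : ∀ k, sq k → V (k + 1) =
      (2 * (1 - (3 / 2 : ℝ) * lam k) * V k + (0 : ℝ) * lam k * V k ^ 2)
        / (2 - (2 * (3 / 2 : ℝ) - 1) * lam k))
    (hsq_y : ∀ k, sq k → y (k + 1) = 2 * (1 - ((3 / 2 : ℝ) - 1) * lam k) * y k)
    (hsq_ℓ : ∀ k, sq k → ℓ (k + 1) = 2 * ℓ k)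
    (hsq_floor : ∀ k, sq k → (1 / 7 : ℝ) ≤ V (k + 1))
    (hμ : ∀ k, ¬ sq k → 0 < μ k ∧ (2 * (3 / 2 : ℝ) - 1) * μ k ≤ 1)
    (hb_lam : ∀ k, ¬ sq k → lam (k + 1) = lam k + μ k - (2 * (3 / 2 : ℝ) - 1) * lam k * μ k)
    (hb_V : ∀ k, ¬ sq k → V (k + 1) * lam (k + 1) =
      μ k * (1 - (3 / 2 : ℝ) * lam k) + lam k * (1 - (3 / 2 : ℝ) * μ k) * V k
        + (0 : ℝ) * lam k * μ k * V k)
    (hb_y : ∀ k, ¬ sq k →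
      y (k + 1) = (1 - ((3 / 2 : ℝ) - 1) * μ k) * y k + (1 - ((3 / 2 : ℝ) - 1) * lam k) * yb k)
    (hyb : ∀ k, ¬ sq k → 0 ≤ yb k ∧ yb k ≤ R * μ k)
    (hb_ℓ : ∀ k, ¬ sq k → ℓ (k + 1) = ℓ k + ℓb k) (hℓb : ∀ k, ¬ sq k → 0 ≤ ℓb k) :
    ∀ k, y k ≤
      max (3 * (R * (2 * (3 / 2 : ℝ) - 1) / ((3 / 2 : ℝ) * (1 - (9 / 10 : ℝ)) * ((3 / 2 : ℝ) - 1))))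
          (y 0)
      * ((1 / (2 * (3 / 2 : ℝ) - 1)) / lam 0) * (1 - (5 / 6 : ℝ)) ^ (-(9 / 10 : ℝ))
      * (ℓ k / ℓ 0) ^ (Real.log (4 / 3) / Real.log 2) := by
  exact chain_cap_rpow (by norm_num) (by norm_num) (by norm_num) (by norm_num) (by norm_num) hR
    (by norm_num) (by norm_num) cutoff_three_halves criterion_three_halves lam V y ℓ μ yb ℓb sq
    hlam0 hlam0' hV0 hV0' hy0 hℓ0 hsq_lam hsq_V hsq_y hsq_ℓ hsq_floor hμ hb_lam hb_V hb_y hyb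
    hb_ℓ hℓb

/-! ## β = 19/10 -/

/-- **Squaring criterion at `β = 19/10`** (`z = 99/100`, `V_min = 457/10000`, `γ = 9/10`):
one share cell. -/
theorem criterion_nineteen_tenths :
    ∀ lam V : ℝ, 0 < lam → (2 * (19 / 10 : ℝ) - 1) * lam ≤ 1 → 0 ≤ V → V < 1 →
      (457 / 10000 : ℝ) ≤
        (2 * (1 - (19 / 10 : ℝ) * lam) * V + (99 / 100 : ℝ) * lam * V ^ 2)
          / (2 - (2 * (19 / 10 : ℝ) - 1) * lam) →
      Real.log (2 * (1 - ((19 / 10 : ℝ) - 1) * lam) / (2 - (2 * (19 / 10 : ℝ) - 1) * lam))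
          - Real.log (4 / 3) ≤
        (9 / 10 : ℝ) *
          (Real.log (1 - (2 * (1 - (19 / 10 : ℝ) * lam) * V + (99 / 100 : ℝ) * lam * V ^ 2)
            / (2 - (2 * (19 / 10 : ℝ) - 1) * lam)) - Real.log (1 - V)) := by
  intro lam V h0 h1 hV0 hV1 hfloor
  have hβ : (1:ℝ) < 19 / 10 := by norm_num
  rcases le_or_gt lam (10 / 29) with hlow | hgt
  · exact crit_low hβ (by norm_num) (by norm_num) h0 h1 (by linarith) hV0 hV1 hfloor
  · refine crit_cell (la := 10 / 29) (lb := 5 / 14) (W := 663 / 10000) hβ (by norm_num)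
      (by norm_num) (by norm_num) (by norm_num) (by norm_num) (by norm_num) (by norm_num)
      (by norm_num) (by norm_num) ?_ hgt.le (by linarith) hV0 hV1 hfloor
    exact check_nine_tenths (by norm_num) (by norm_num) (by norm_num) (by norm_num)

/-- The cut-off condition at `β = 19/10`, `z = 99/100`, `V† = 599/600`, `γ = 9/10`. -/
theorem cutoff_nineteen_tenths :
    Real.log (2 * (19 / 10 : ℝ) / (2 * (19 / 10 : ℝ) - 1)) - Real.log (4 / 3) ≤
      (9 / 10 : ℝ) * (Real.log ((1 - (99 / 100 : ℝ)) / 3) - Real.log (1 - (599 / 600 : ℝ))) :=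
  check_nine_tenths (by norm_num) (by norm_num) (by norm_num) (by norm_num)

/-- **Chain cap at `β = 19/10`, unconditionally.**  Every chain schedule of the floor-projected dial
(narrowness at `z = 99/100`, one node floor of depth `10` giving `V' ≥ 457/10000` on squarings,
heavy bases `b ≥ 9/10`) has `y_k ≤ C·(ℓ_k/ℓ_0)^{log₂(4/3)}` with the explicit `C` below. -/
theorem chain_cap_nineteen_tenths {R : ℝ} (hR : 0 ≤ R)
    (lam V y ℓ μ yb ℓb : ℕ → ℝ) (sq : ℕ → Prop)
    (hlam0 : 0 < lam 0) (hlam0' : (2 * (19 / 10 : ℝ) - 1) * lam 0 ≤ 1) (hV0 : 0 ≤ V 0)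
    (hV0' : V 0 ≤ 1)
    (hy0 : 0 < y 0) (hℓ0 : 0 < ℓ 0)
    (hsq_lam : ∀ k, sq k → lam (k + 1) = 2 * lam k - (2 * (19 / 10 : ℝ) - 1) * lam k ^ 2)
    (hsq_V : ∀ k, sq k → V (k + 1) =
      (2 * (1 - (19 / 10 : ℝ) * lam k) * V k + (99 / 100 : ℝ) * lam k * V k ^ 2)
        / (2 - (2 * (19 / 10 : ℝ) - 1) * lam k))
    (hsq_y : ∀ k, sq k → y (k + 1) = 2 * (1 - ((19 / 10 : ℝ) - 1) * lam k) * y k)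
    (hsq_ℓ : ∀ k, sq k → ℓ (k + 1) = 2 * ℓ k)
    (hsq_floor : ∀ k, sq k → (457 / 10000 : ℝ) ≤ V (k + 1))
    (hμ : ∀ k, ¬ sq k → 0 < μ k ∧ (2 * (19 / 10 : ℝ) - 1) * μ k ≤ 1)
    (hb_lam : ∀ k, ¬ sq k → lam (k + 1) = lam k + μ k - (2 * (19 / 10 : ℝ) - 1) * lam k * μ k)
    (hb_V : ∀ k, ¬ sq k → V (k + 1) * lam (k + 1) =
      μ k * (1 - (19 / 10 : ℝ) * lam k) + lam k * (1 - (19 / 10 : ℝ) * μ k) * V k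
        + (99 / 100 : ℝ) * lam k * μ k * V k)
    (hb_y : ∀ k, ¬ sq k →
      y (k + 1) = (1 - ((19 / 10 : ℝ) - 1) * μ k) * y k + (1 - ((19 / 10 : ℝ) - 1) * lam k) * yb k)
    (hyb : ∀ k, ¬ sq k → 0 ≤ yb k ∧ yb k ≤ R * μ k)
    (hb_ℓ : ∀ k, ¬ sq k → ℓ (k + 1) = ℓ k + ℓb k) (hℓb : ∀ k, ¬ sq k → 0 ≤ ℓb k) :
    ∀ k, y k ≤
      max (3 * (R * (2 * (19 / 10 : ℝ) - 1)
            / ((19 / 10 : ℝ) * (1 - (9 / 10 : ℝ)) * ((19 / 10 : ℝ) - 1))))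
          (y 0)
      * ((1 / (2 * (19 / 10 : ℝ) - 1)) / lam 0) * (1 - (599 / 600 : ℝ)) ^ (-(9 / 10 : ℝ))
      * (ℓ k / ℓ 0) ^ (Real.log (4 / 3) / Real.log 2) := by
  exact chain_cap_rpow (by norm_num) (by norm_num) (by norm_num) (by norm_num) (by norm_num) hR
    (by norm_num) (by norm_num) cutoff_nineteen_tenths criterion_nineteen_tenths lam V y ℓ μ yb ℓb
    sq
    hlam0 hlam0' hV0 hV0' hy0 hℓ0 hsq_lam hsq_V hsq_y hsq_ℓ hsq_floor hμ hb_lam hb_V hb_y hyb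
    hb_ℓ hℓb

end Summit.MatrixMultiplication.MatrixMultiplication.Theorems.FarEdgeDescentChainCapInstances
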